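/-
Copyright (c) 2026 the pub-hodgecm-mathlib formalisation cell (harness21).  Prover seat hodgecm-mathlib-K2-defs1 (g6), Track B, h413 = `stmt-HodgeConjecture-24833`, route `HCCMUnconditional`,
campaign «5Res (b) BL-2(χ,τ)», deal (174) of dealer K2E1-plan (g7) 2026-09-04T11:52:24Z (the ARCH test-function payer of convData_χ's letters `hfam`∕`hnc`); REPORT-FIRST 12:02Z: P1 here.
-/
import Summits.HodgeConjecture.HodgeConjecture.Theorems.K2E1ChiHeckeArchScalarU2        -- ★ p859887 (this seat) 12d-C: `exists_integral_pureTensor_mul_flatSectionU_eq` (the per-`z` scalar)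
import Summits.HodgeConjecture.HodgeConjecture.Theorems.K2E1ChiEisensteinHeckeMatrixU2    -- ★ row 10 (K2E1-p10): `differentiable_rightConvSection_apply` (entire entries)
import HarnessLib

/-!
# (174) P1 — `K2E1ArchTestFunctionSymbolU2`: THE ARCHIMEDEAN SCALAR IS ONE ENTIRE SYMBOL — for the pure tensor `h = h_∞ ⊗ 𝟙_U` of ★ 12d-C there is a single ENTIRE `s : ℂ → ℂ` with
# `∫_G h(y)·f_z^φ(x y) dν_G = s(z)·f_z^φ(x)` for ALL `z`, ALL `φ ∈ V(χ, K′, ω)`, ALL `x` (the `Differentiable ℂ s ∧ ‹action›` half of convData_χ's letter `hfam`)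

Cell `pub/hodgecm-mathlib`, crux H413 = `stmt-HodgeConjecture-24833`.  THEOREMS ONLY (no `def`, no `instance`, no notation, no named-fact hypothesis, no `sorry`); lane `--supports
stmt-HodgeConjecture-24833 --as helper` (count-neutral).  Closes no socket.  Generic `(F, E, c)` with `c ≠ 1` fixing the infinite places, every rank `N`.

THE MATHEMATICS ([BernsteinLapid2019, §4 Claim 1]; [Langlands1976, §6]).  ★ 12d-C gives, for EACH `z`, a scalar `s_z` with `∫ h·f_z^φ(x·) = s_z·f_z^φ(x)` on `V = chiSectionSpace χ K′ ω`.  If `V` has a section with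
`φ₀(x₀) ≠ 0`, then `s_z = (∫ h(y)·f_z^{φ₀}(x₀y) dν_G)∕f_z^{φ₀}(x₀)`, and the numerator times `H(x₀)^{−z}` is ENTIRE in `z` (★ row 10 `differentiable_rightConvSection_apply`: substitution `y ↦ x₀⁻¹y`
and ★ ℓ9 (a)), so `z ↦ s_z` is one entire function; if `V` has no such section then every `φ ∈ V` vanishes and `s ≡ 1` serves.  This is convData_χ's `hfam` (★ p859925, letters of K2E1-p14
R4) MINUS the two analytic clauses `s z₀ ≠ 0` (P2: the archimedean tube argument with the phase `χ_∞(b)ω(k)`) and `∃ z₁ z₂, s z₁ ≠ s z₂` (P3: growth of the archimedean transform at `χ_∞ = 1`),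
which are NOT proved here and stay letters with those payers.
* §1 `flatSectionU_ne_zero` (`f_z^φ(x) ≠ 0 ⟸ φ(x) ≠ 0`), `eq_zero_of_forall_apply_eq_zero'` (the degenerate case), **`exists_entire_symbol_of_arch`** (HEAD).
HONEST LABEL: HC_CM is proved only modulo the 7 printed citations (2 remaining named inputs: hLiu418 = `stmt-HodgeConjecture-24832`, h413 = `stmt-HodgeConjecture-24833`) until rung 0
closes; count-neutral helper, closes no socket.

## References
* [BernsteinLapid2019] J. Bernstein, E. Lapid, *On the meromorphic continuation of Eisenstein series*, J. Amer. Math. Soc. 37 (2024) (arXiv:1911.02342), §4 Claim 1.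
* [Langlands1976] R. P. Langlands, *On the Functional Equations Satisfied by Eisenstein Series*, LNM 544 (1976), §6 (p. 167).
-/

set_option autoImplicit false
-- the mandated namespace repeats the single-problem summit's segment (`HodgeConjecture.HodgeConjecture`)
set_option linter.dupNamespace false

noncomputable section

open MeasureTheory Measure NumberField IsDedekindDomain NumberField.InfinitePlace NumberField.mixedEmbedding
open scoped NNReal MatrixGroups Classical
open Literature.NumberTheory.Automorphic Literature.NumberTheory.Automorphic.UnitaryGroup AdelicGroupData
open Literature.NumberTheory.GaloisRepresentations (HeckeCharacter)
open Summit.HodgeConjecture.HodgeConjecture.Cruxes.H413.K2E1BorelEisensteinU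
open Summit.HodgeConjecture.HodgeConjecture.Cruxes.H413.K2E1CharacterEisensteinU2Defs
open Summit.HodgeConjecture.HodgeConjecture.Cruxes.H413.K2E1ChiSectionSpaceU2Defs
open Summit.HodgeConjecture.HodgeConjecture.Cruxes.H413.K2E1ChiHeckeArchScalarU2 (exists_integral_pureTensor_mul_flatSectionU_eq)
open Summit.HodgeConjecture.HodgeConjecture.Cruxes.H413.K2E1ChiEisensteinHeckeMatrixU2 (differentiable_rightConvSection_apply)

namespace Summit.HodgeConjecture.HodgeConjecture.Cruxes.H413.K2E1ArchTestFunctionSymbolU2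

variable {F E : Type} [Field F] [NumberField F] [Field E] [NumberField E] [Algebra F E] {c : E ≃ₐ[F] E} {N : ℕ} [NeZero N]

/-- `f_z^φ(x) ≠ 0` whenever `φ(x) ≠ 0` (`H(x)^z ≠ 0`, `H > 0`). [folklore] -/
theorem flatSectionU_ne_zero {φ : (quasiSplit F E c N).Adelic → ℂ} {x : (quasiSplit F E c N).Adelic} (hφ : φ x ≠ 0) (z : ℂ) : flatSectionU φ z x ≠ 0 := by
  rw [flatSectionU_apply]
  refine mul_ne_zero hφ ?_
  rw [Ne, Complex.cpow_eq_zero_iff, not_and_or]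
  exact Or.inl (Complex.ofReal_ne_zero.2 (ne_of_gt (by exact_mod_cast borelHeight_pos x)))

variable [MeasurableSpace (quasiSplit F E c N).Adelic] [BorelSpace (quasiSplit F E c N).Adelic]
variable [MeasurableSpace (arch F E c N ((StdForm.antidiagonal N).over E))] [BorelSpace (arch F E c N ((StdForm.antidiagonal N).over E))]
variable [MeasurableSpace (finAdelic F E c N ((StdForm.antidiagonal N).over E))] [BorelSpace (finAdelic F E c N ((StdForm.antidiagonal N).over E))]
variable (νG : Measure (quasiSplit F E c N).Adelic) [νG.IsHaarMeasure]
variable (μa : Measure (arch F E c N ((StdForm.antidiagonal N).over E))) [μa.IsHaarMeasure] [μa.IsMulRightInvariant]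
variable (μf : Measure (finAdelic F E c N ((StdForm.antidiagonal N).over E))) [μf.IsHaarMeasure]
variable {χ : HeckeCharacter E} {K' : Subgroup (quasiSplit F E c N).Adelic} {ω : ↥K' → ℂ}

include μa μf in
/-- **(174) P1 HEAD — THE ARCHIMEDEAN SCALAR IS ONE ENTIRE SYMBOL**: for the pure tensor `h = h_∞ ⊗ 𝟙_U` of ★ 12d-C (`c ≠ 1` fixing the infinite places, `h_∞` `K_∞`-central, `ι_f(U) ⊆ K′` acting trivially,
`K′ ≤ K`, `K′ ⊇ ι(K_∞)`, two-sided Haar `μ_∞`) with `h` continuous of compact support, and `V = chiSectionSpace χ K′ ω` consisting of continuous functions, there is ONE ENTIRE `s : ℂ → ℂ` with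
`∫_G h(y)·f_z^φ(x y) dν_G = s(z)·f_z^φ(x)` for all `z`, all `φ ∈ V`, all `x` — the `Differentiable ℂ s ∧ ‹action›` clauses of convData_χ's `hfam` (★ p859925).  (`s_z` from ★ 12d-C is
`(R(h)f_z^{φ₀})(x₀)∕f_z^{φ₀}(x₀)` at any non-vanishing value, entire by ★ `differentiable_rightConvSection_apply`; `s ≡ 1` if `V` has none.)  NOT here: `s z₀ ≠ 0` (P2), non-constancy (P3).
[cite: BernsteinLapid2019, §4 Claim 1] [cite: Langlands1976, §6 (p. 167)] -/
theorem exists_entire_symbol_of_arch (hc : c ≠ 1) (hfix : ∀ w : InfinitePlace E, c • w = w)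
    (hK' : K' ≤ ((standardMaximalCompactGL N E).comap (adelicVal F E c N ((StdForm.antidiagonal N).over E)) : Subgroup (quasiSplit F E c N).Adelic))
    (hKinf : ∀ k : arch F E c N ((StdForm.antidiagonal N).over E),
      adelicVal F E c N ((StdForm.antidiagonal N).over E) (archToAdelic F E c N _ k) ∈ standardMaximalCompactGL N E → archToAdelic F E c N _ k ∈ K')
    {h : (quasiSplit F E c N).Adelic → ℂ} (hh : Continuous h) (hhs : HasCompactSupport h)
    {hinf : arch F E c N ((StdForm.antidiagonal N).over E) → ℂ} {U : Set (finAdelic F E c N ((StdForm.antidiagonal N).over E))}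
    (hten : ∀ y, h y = hinf (archPart F E c N _ y) * U.indicator (fun _ => (1 : ℂ)) (finPart F E c N _ y))
    (hcent : ∀ k ∈ (((standardMaximalCompactGL N E).comap (adelicVal F E c N ((StdForm.antidiagonal N).over E))).comap (archToAdelic F E c N ((StdForm.antidiagonal N).over E))),
      ∀ y, hinf (k⁻¹ * y * k) = hinf y)
    (hU : ∀ b ∈ U, ∃ hb : finAdelicToAdelic F E c N ((StdForm.antidiagonal N).over E) b ∈ K', ω ⟨_, hb⟩ = 1)
    (hVc : ∀ φ ∈ chiSectionSpace χ K' ω, Continuous φ) :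
    ∃ s : ℂ → ℂ, Differentiable ℂ s ∧ ∀ (z : ℂ), ∀ φ ∈ chiSectionSpace χ K' ω, ∀ x : (quasiSplit F E c N).Adelic,
      ∫ y, h y * flatSectionU φ z (x * y) ∂νG = s z * flatSectionU φ z x := by
  -- the per-`z` scalars of ★ 12d-C
  choose s hs using fun z => exists_integral_pureTensor_mul_flatSectionU_eq νG μa μf hc hfix hK' hKinf hten hcent hU z
  by_cases hV : ∃ φ₀ ∈ chiSectionSpace χ K' ω, ∃ x₀ : (quasiSplit F E c N).Adelic, φ₀ x₀ ≠ 0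
  · obtain ⟨φ₀, hφ₀, x₀, hx₀⟩ := hV
    have hne : (((borelHeight x₀ : ℝ≥0) : ℝ) : ℂ) ≠ 0 := Complex.ofReal_ne_zero.2 (ne_of_gt (by exact_mod_cast borelHeight_pos x₀))
    -- `s z = (R(h) f_z^{φ₀})(x₀)·H(x₀)^{−z} ∕ φ₀(x₀)`, an entire function of `z`
    have hsz : ∀ z, s z = ((∫ y, h y * flatSectionU φ₀ z (x₀ * y) ∂νG) * (((borelHeight x₀ : ℝ≥0) : ℝ) : ℂ) ^ (-z)) / φ₀ x₀ := fun z => by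
      rw [hs z φ₀ hφ₀ x₀, flatSectionU_apply, eq_div_iff hx₀, mul_assoc, mul_assoc, ← Complex.cpow_add _ _ hne, add_neg_cancel, Complex.cpow_zero, mul_one]
    refine ⟨s, ?_, hs⟩
    rw [show s = fun z => ((∫ y, h y * flatSectionU φ₀ z (x₀ * y) ∂νG) * (((borelHeight x₀ : ℝ≥0) : ℝ) : ℂ) ^ (-z)) / φ₀ x₀ from funext hsz]
    exact (differentiable_rightConvSection_apply νG hh hhs (hVc φ₀ hφ₀) x₀).div_const _
  · -- no section has a non-zero value: every `φ ∈ V` is `0`, and `s ≡ 1` serves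
    push Not at hV
    refine ⟨fun _ => 1, differentiable_const 1, fun z φ hφ x => ?_⟩
    have hφ0 : φ = 0 := funext fun y => hV φ hφ y
    subst hφ0
    have h0 : ∀ y, flatSectionU (0 : (quasiSplit F E c N).Adelic → ℂ) z y = 0 := fun y => by rw [flatSectionU_apply, Pi.zero_apply, zero_mul]
    simp only [h0, mul_zero, integral_zero]

end Summit.HodgeConjecture.HodgeConjecture.Cruxes.H413.K2E1ArchTestFunctionSymbolU2
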